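import Summits.RiemannHypothesis.RiemannHypothesis.Theorems.WeilGroundStateGroundStatesConvergeToXiEnergyLimit
import Summits.RiemannHypothesis.RiemannHypothesis.Theorems.OddSectorOddOneSignedWindowsEnergyFloorCore
import Literature.NumberTheory.LFunctions.WeilMellinBounds
import Literature.NumberTheory.LFunctions.DeBruijnPhiDecreasing
import Literature.NumberTheory.LFunctions.SelbergDeltaAssembly
import HarnessLib

/-!
# A super-exponential upper bound for the ODD ground energy, and `RH ⟺ ε_od(a) → 0`
# (helper for item stmt-RiemannHypothesis-17778, crux `OddSector.OddOneSignedWindows`; RH-free)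

Odd-sector twin of `GroundStatesConvergeToXi.weilGroundEnergy_le_superexp` (route WeilGroundState,
file `…EnergyUpper.lean`). The truncated Riemann kernel `φ_a = Φχ_a` used there is EVEN; its
derivative `ψ_a := φ_a′` is an ODD test function on `[−a, a]` with `ψ̂_a(s) = −(s − ½) φ̂_a(s)`
(`weilMellin_deriv`), so at a non-trivial zero `ρ` (where `φ̂_a(ρ)` is the tiny tail transform,
`exists_norm_weilMellin_phiCut_zero_le`) `‖ψ̂_a(ρ)‖ ≤ ‖ρ − ½‖ · D e^{−(π/4)e^{2(a−1)}}/(1+γ²)`, and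
the explicit formula gives `‖Q(ψ_a)‖ ≤ D² Z₁ e^{−(π/2)e^{2(a−1)}}` with `Z₁ = Σ_ρ m(ρ)/(1+γ²) < ∞`
(`SelbergDelta.summable_zeroOrder_div_one_add_im_sq`, Literature, from the tree's Jensen bound
`summable_zeroOrder_div_norm_sq`; one power of `1+γ²` is spent on `‖ρ − ½‖² ≤ 1 + γ²`). Since
`ψ_a = Φ′` on `[−(a−1), a−1]` and `Φ′(1) < 0`, `‖ψ_a‖₂² ≥ N₁ > 0` for `a ≥ 3`, whence

* `weilOddGroundEnergy_le_superexp` — **`ε_od(a) ≤ C exp(−(π/2)e^{2(a−1)})` for `a ≥ 3`** (RH-free);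
* `weilOddGroundEnergy_eventually_le` — `limsup ε_od ≤ 0` unconditionally;
* `riemannHypothesis_iff_tendsto_weilOddGroundEnergy_zero` — **`RH ⟺ ε_od(a) → 0`**, and the
  RH-free DICHOTOMY `tendsto_weilOddGroundEnergy_zero_or_eventually_le_neg`: `ε_od → 0` (iff RH) or
  `ε_od ≤ −η < 0` beyond some height (iff ¬RH);
* under RH the two-sided squeeze `0 ≤ ε_od(a) ≤ C exp(−(π/2)e^{2(a−1)})`
  (`weilOddGroundEnergy_mem_Icc_of_riemannHypothesis`).

For the crux: under RH the odd bottom state that `OddOneSignedWindows` asks to be one-signed has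
energy in `[0, C e^{−(π/2)e^{2(a−1)}}]`, the scale at which the item's numerics find its sign
decided. No new definitions (all objects inline).
-/

noncomputable section

set_option linter.dupNamespace false

open scoped Topology Real ComplexConjugate
open Filter Set MeasureTheory Complex

namespace Summit.RiemannHypothesis.RiemannHypothesis.Theorems.OddSector

open Literature.NumberTheory.LFunctions
open Summit.RiemannHypothesis.RiemannHypothesis.Theorems.GroundStatesConvergeToXi

/-! ## The odd trial function `ψ_a = (Φχ_a)′` -/

/-- The truncated kernel `φ_a = Φχ_a` is even (`Ψ` even, `χ_a` even). [folklore] -/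
theorem phiCut_neg (a t : ℝ) :
    (2 : ℂ) * LagariasMontague.Psic (2 * -t) * ((Literature.Analysis.Calculus.cutoff a (-t) : ℝ) : ℂ) =
      (2 : ℂ) * LagariasMontague.Psic (2 * t) * ((Literature.Analysis.Calculus.cutoff a t : ℝ) : ℂ) := by
  have h1 : LagariasMontague.Psic (2 * -t) = LagariasMontague.Psic (2 * t) := by
    simp only [LagariasMontague.Psic, mul_neg, LagariasMontague.Psi_neg]
  have h2 : Literature.Analysis.Calculus.cutoff a (-t) = Literature.Analysis.Calculus.cutoff a t := by
    simp only [Literature.Analysis.Calculus.cutoff]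
    rw [mul_comm]
    congr 1 <;> ring_nf
  rw [h1, h2]

/-- The derivative `ψ_a = φ_a′` is odd. [folklore] -/
theorem deriv_phiCut_neg (a t : ℝ) :
    deriv (fun t : ℝ => (2 : ℂ) * LagariasMontague.Psic (2 * t) *
        ((Literature.Analysis.Calculus.cutoff a t : ℝ) : ℂ)) (-t) =
      -deriv (fun t : ℝ => (2 : ℂ) * LagariasMontague.Psic (2 * t) *
        ((Literature.Analysis.Calculus.cutoff a t : ℝ) : ℂ)) t := by
  set φ : ℝ → ℂ := fun t : ℝ => (2 : ℂ) * LagariasMontague.Psic (2 * t) *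
    ((Literature.Analysis.Calculus.cutoff a t : ℝ) : ℂ) with hφ
  have heven : (fun x => φ (-x)) = φ := funext fun x => phiCut_neg a x
  have h := deriv_comp_neg φ t
  rw [heven] at h
  -- `h : deriv φ t = -deriv φ (-t)`
  rw [h, neg_neg]

/-- On the plateau `|t| < a − 1` the trial function IS `Φ′`: `ψ_a(t) = Φ′(t)`. [folklore] -/
theorem deriv_phiCut_eq_weilThetaPhiDeriv {a t : ℝ} (ht : |t| < a - 1) :
    deriv (fun t : ℝ => (2 : ℂ) * LagariasMontague.Psic (2 * t) *
        ((Literature.Analysis.Calculus.cutoff a t : ℝ) : ℂ)) t = (weilThetaPhiDeriv t : ℂ) := by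
  have hloc : (fun x : ℝ => (2 : ℂ) * LagariasMontague.Psic (2 * x) *
      ((Literature.Analysis.Calculus.cutoff a x : ℝ) : ℂ)) =ᶠ[𝓝 t] fun x => ((weilThetaPhi x : ℝ) : ℂ) := by
    have hopen : IsOpen {x : ℝ | |x| < a - 1} := isOpen_lt continuous_abs continuous_const
    filter_upwards [hopen.mem_nhds ht] with x hx
    have hx' : |x| ≤ a - 1 := le_of_lt hx
    rw [Literature.Analysis.Calculus.cutoff_eq_one hx', weilThetaPhi_eq_two_mul_Psi]
    simp [LagariasMontague.Psic]
  rw [hloc.deriv_eq]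
  exact ((hasDerivAt_weilThetaPhi t).ofReal_comp).deriv

/-- **Uniform lower bound `‖ψ_a‖₂² ≥ N₁ > 0` for `a ≥ 3`** (`ψ_a = Φ′` on `[−2, 2]`, and
`Φ′(1) < 0`). [folklore] -/
theorem exists_integral_norm_sq_deriv_phiCut_ge :
    ∃ N₁ : ℝ, 0 < N₁ ∧ ∀ a : ℝ, 3 ≤ a → N₁ ≤ ∫ t : ℝ, ‖deriv (fun t : ℝ => (2 : ℂ) *
      LagariasMontague.Psic (2 * t) * ((Literature.Analysis.Calculus.cutoff a t : ℝ) : ℂ)) t‖ ^ 2 := by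
  set g : ℝ → ℝ := fun t => weilThetaPhiDeriv t ^ 2 * Literature.Analysis.Calculus.cutoff 2 t
    with hgdef
  have hgc : Continuous g := (continuous_weilThetaPhiDeriv.pow 2).mul
    (Literature.Analysis.Calculus.contDiff_cutoff 2 (n := 0)).continuous
  have hgs : HasCompactSupport g := by
    refine HasCompactSupport.intro (isCompact_Icc (a := -2) (b := 2)) fun t ht => ?_
    have hta : 2 ≤ |t| := by
      simp only [mem_Icc, not_and_or, not_le] at ht
      rcases ht with h | h
      · linarith [neg_abs_le t]
      · linarith [le_abs_self t]
    simp [hgdef, Literature.Analysis.Calculus.cutoff_eq_zero hta]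
  have hg0 : 0 ≤ g := fun t =>
    mul_nonneg (sq_nonneg _) (Literature.Analysis.Calculus.cutoff_nonneg 2 t)
  have hgpt : g 1 ≠ 0 := by
    have h1 : Literature.Analysis.Calculus.cutoff 2 1 = 1 :=
      Literature.Analysis.Calculus.cutoff_eq_one (by norm_num)
    have h2 : weilThetaPhiDeriv 1 ≠ 0 := (weilThetaPhiDeriv_neg_of_pos one_pos).ne
    simp only [hgdef, h1, mul_one]
    exact pow_ne_zero 2 h2
  refine ⟨∫ t, g t, hgc.integral_pos_of_hasCompactSupport_nonneg_nonzero hgs hg0 hgpt,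
    fun a ha => ?_⟩
  set ψ : ℝ → ℂ := deriv (fun t : ℝ => (2 : ℂ) * LagariasMontague.Psic (2 * t) *
    ((Literature.Analysis.Calculus.cutoff a t : ℝ) : ℂ)) with hψdef
  have hψ : IsWeilTest ψ := (isWeilTest_phiCut a).deriv
  have hcs : HasCompactSupport fun t : ℝ => ‖ψ t‖ ^ 2 := by
    have h := hψ.2.norm.mul_right (f' := fun t : ℝ => ‖ψ t‖)
    have e : (fun t : ℝ => ‖ψ t‖ ^ 2) = (fun t : ℝ => ‖ψ t‖) * fun t : ℝ => ‖ψ t‖ := by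
      funext t
      simp [pow_two]
    rw [e]
    exact h
  refine integral_mono (hgc.integrable_of_hasCompactSupport hgs)
    ((hψ.1.continuous.norm.pow 2).integrable_of_hasCompactSupport hcs) fun t => ?_
  simp only [hgdef]
  by_cases ht : 2 ≤ |t|
  · rw [Literature.Analysis.Calculus.cutoff_eq_zero ht, mul_zero]
    positivity
  · have ht' : |t| < a - 1 := by linarith [not_le.1 ht]
    rw [hψdef, deriv_phiCut_eq_weilThetaPhiDeriv ht', Complex.norm_real, Real.norm_eq_abs, sq_abs]
    exact mul_le_of_le_one_right (sq_nonneg _) (Literature.Analysis.Calculus.cutoff_le_one 2 t)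

/-! ## The energy of the odd trial function via the explicit formula -/

/-- **`Q(ψ_a)` is double-exponentially small**: there is `C ≥ 0` with
`‖weilQuadratic ψ_a‖ ≤ C exp(−(π/2)e^{2(a−1)})` for all `a ≥ 1`. By the explicit formula
(`explicit_formula_holds`, absolutely convergent zero side),
`Q(ψ_a) = Σ_ρ m(ρ) ψ̂_a(ρ) conj ψ̂_a(1−ρ̄)` with `ψ̂_a = −(· − ½) φ̂_a` (`weilMellin_deriv`), both
factors tail transforms at zeros of `ξ` times `‖ρ − ½‖ ≤ (1 + γ²)^{1/2}`. RH-free. [folklore] -/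
theorem exists_norm_weilQuadratic_deriv_phiCut_le :
    ∃ C : ℝ, 0 ≤ C ∧ ∀ a : ℝ, 1 ≤ a →
      ‖weilQuadratic (deriv fun t : ℝ => (2 : ℂ) * LagariasMontague.Psic (2 * t) *
          ((Literature.Analysis.Calculus.cutoff a t : ℝ) : ℂ))‖ ≤
        C * Real.exp (-(π / 2 * Real.exp (2 * (a - 1)))) := by
  -- adapted from `exists_norm_weilQuadratic_phiCut_le` (…ConvergeToXiEnergyUpper.lean)
  obtain ⟨D, hD, hZ⟩ := exists_norm_weilMellin_phiCut_zero_le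
  set Z₁ : ℝ := ∑' ρ : ZetaZeros.riemannZetaNontrivialZeros,
    (riemannZetaZeroOrder (ρ : ℂ) : ℝ) / (1 + (ρ : ℂ).im ^ 2) with hZ₁
  have hw0 : ∀ ρ : ZetaZeros.riemannZetaNontrivialZeros,
      0 ≤ (riemannZetaZeroOrder (ρ : ℂ) : ℝ) / (1 + (ρ : ℂ).im ^ 2) := by
    intro ρ
    have hm : (0 : ℝ) ≤ riemannZetaZeroOrder (ρ : ℂ) := by
      exact_mod_cast riemannZetaZeroOrder_nonneg (ZetaZeros.riemannZetaNontrivialZeros.ne_one ρ.2)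
    positivity
  have hZ₁0 : 0 ≤ Z₁ := tsum_nonneg hw0
  refine ⟨D ^ 2 * Z₁, by positivity, fun a ha => ?_⟩
  set φ : ℝ → ℂ := fun t : ℝ => (2 : ℂ) * LagariasMontague.Psic (2 * t) *
    ((Literature.Analysis.Calculus.cutoff a t : ℝ) : ℂ) with hφdef
  set ψ : ℝ → ℂ := deriv φ with hψdef
  set η : ℝ := Real.exp (-(π / 4 * Real.exp (2 * (a - 1)))) with hη
  have hη2 : Real.exp (-(π / 2 * Real.exp (2 * (a - 1)))) = η ^ 2 := by
    rw [hη, ← Real.exp_nat_mul]; congr 1; push_cast; ring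
  have hφ : IsWeilTest φ := isWeilTest_phiCut a
  have hψ : IsWeilTest ψ := hφ.deriv
  have hψr : IsWeilTest (weilReflect ψ) := hψ.weilReflect
  have hk : IsWeilTest (weilConv ψ (weilReflect ψ)) := hψ.weilConv hψr
  -- explicit formula, absolutely convergent form
  have hsum := summable_norm_zeroSide hk
  have hW : weilQuadratic ψ = ∑' ρ : ZetaZeros.riemannZetaNontrivialZeros,
      (riemannZetaZeroOrder (ρ : ℂ) : ℂ) * weilMellin (weilConv ψ (weilReflect ψ)) ρ :=
    tendsto_nhds_unique (explicit_formula_holds hk) (hasWeilZeroSide_tsum hsum)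
  -- the transform of the derivative at the two points
  have hMψ : ∀ s : ℂ, weilMellin ψ s = -(s - 1 / 2) * weilMellin φ s := fun s =>
    weilMellin_deriv hφ s
  -- termwise bound
  have hterm : ∀ ρ : ZetaZeros.riemannZetaNontrivialZeros,
      ‖(riemannZetaZeroOrder (ρ : ℂ) : ℂ) * weilMellin (weilConv ψ (weilReflect ψ)) ρ‖ ≤
        D ^ 2 * η ^ 2 * ((riemannZetaZeroOrder (ρ : ℂ) : ℝ) / (1 + (ρ : ℂ).im ^ 2)) := by
    intro ρ
    have hρ := ρ.2
    have hρ' := ZetaZeros.riemannZetaNontrivialZeros.one_sub_conj_mem hρ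
    have hm : (0 : ℝ) ≤ riemannZetaZeroOrder (ρ : ℂ) := by
      exact_mod_cast riemannZetaZeroOrder_nonneg (ZetaZeros.riemannZetaNontrivialZeros.ne_one hρ)
    rw [weilMellin_weilConv_holds hψ.1.continuous hψ.2 hψr.1.continuous hψr.2,
      weilMellin_weilReflect_holds ψ ρ, norm_mul, norm_mul, Complex.norm_intCast, abs_of_nonneg hm,
      Complex.norm_conj, hMψ, hMψ, norm_mul, norm_mul, norm_neg, norm_neg]
    have hA := hZ a ha ρ hρ
    have hB := hZ a ha (1 - conj (ρ : ℂ)) hρ'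
    have him : (1 - conj (ρ : ℂ)).im = (ρ : ℂ).im := by simp
    rw [him] at hB
    have hpos : 0 < 1 + (ρ : ℂ).im ^ 2 := by positivity
    -- `‖ρ - 1/2‖ = ‖(1 - conj ρ) - 1/2‖` and `‖ρ - 1/2‖² ≤ 1 + γ²`
    have h0 := ZetaZeros.riemannZetaNontrivialZeros.re_pos hρ
    have h1 := ZetaZeros.riemannZetaNontrivialZeros.re_lt_one hρ
    have hn1 : ‖(1 - conj (ρ : ℂ)) - 1 / 2‖ = ‖(ρ : ℂ) - 1 / 2‖ := by
      have : (1 - conj (ρ : ℂ)) - 1 / 2 = -conj ((ρ : ℂ) - 1 / 2) := by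
        simp only [map_sub, map_div₀, map_one, map_ofNat]
        ring
      rw [this, norm_neg, Complex.norm_conj]
    have hn2 : ‖(ρ : ℂ) - 1 / 2‖ ^ 2 ≤ 1 + (ρ : ℂ).im ^ 2 := by
      rw [← Complex.normSq_eq_norm_sq, Complex.normSq_apply]
      simp only [sub_re, sub_im, one_div]
      norm_num
      nlinarith
    rw [hn1]
    set r : ℝ := ‖(ρ : ℂ) - 1 / 2‖ with hr
    have hr0 : 0 ≤ r := norm_nonneg _
    calc (riemannZetaZeroOrder (ρ : ℂ) : ℝ) *
          (r * ‖weilMellin φ ρ‖ * (r * ‖weilMellin φ (1 - conj (ρ : ℂ))‖))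
        = (riemannZetaZeroOrder (ρ : ℂ) : ℝ) * (r ^ 2 *
            (‖weilMellin φ ρ‖ * ‖weilMellin φ (1 - conj (ρ : ℂ))‖)) := by ring
      _ ≤ (riemannZetaZeroOrder (ρ : ℂ) : ℝ) * ((1 + (ρ : ℂ).im ^ 2) *
            ((D * η / (1 + (ρ : ℂ).im ^ 2)) * (D * η / (1 + (ρ : ℂ).im ^ 2)))) := by
          refine mul_le_mul_of_nonneg_left ?_ hm
          exact mul_le_mul hn2 (mul_le_mul hA hB (norm_nonneg _) (by positivity))
            (by positivity) (by positivity)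
      _ = D ^ 2 * η ^ 2 * ((riemannZetaZeroOrder (ρ : ℂ) : ℝ) / (1 + (ρ : ℂ).im ^ 2)) := by
          field_simp
  have hsum' : Summable fun ρ : ZetaZeros.riemannZetaNontrivialZeros =>
      D ^ 2 * η ^ 2 * ((riemannZetaZeroOrder (ρ : ℂ) : ℝ) / (1 + (ρ : ℂ).im ^ 2)) :=
    SelbergDelta.summable_zeroOrder_div_one_add_im_sq.mul_left _
  rw [hW, hη2]
  calc ‖∑' ρ : ZetaZeros.riemannZetaNontrivialZeros,
        (riemannZetaZeroOrder (ρ : ℂ) : ℂ) * weilMellin (weilConv ψ (weilReflect ψ)) ρ‖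
      ≤ ∑' ρ : ZetaZeros.riemannZetaNontrivialZeros,
        ‖(riemannZetaZeroOrder (ρ : ℂ) : ℂ) * weilMellin (weilConv ψ (weilReflect ψ)) ρ‖ :=
        norm_tsum_le_tsum_norm hsum
    _ ≤ ∑' ρ : ZetaZeros.riemannZetaNontrivialZeros,
        D ^ 2 * η ^ 2 * ((riemannZetaZeroOrder (ρ : ℂ) : ℝ) / (1 + (ρ : ℂ).im ^ 2)) :=
        hsum.tsum_le_tsum hterm hsum'
    _ = D ^ 2 * η ^ 2 * Z₁ := by rw [tsum_mul_left]
    _ = D ^ 2 * Z₁ * η ^ 2 := by ring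

/-! ## The super-exponential upper bound for the odd ground energy, and its consequences -/

/-- **SUPER-EXPONENTIAL UPPER BOUND FOR THE ODD GROUND ENERGY (RH-free; registered sub-goal
`weilOddGroundEnergy_le_superexp` of item stmt-RiemannHypothesis-17778).** There is `C ≥ 0` such that
`ε_od(a) = weilOddGroundEnergy a ≤ C · exp(−(π/2) e^{2(a−1)})` for every window `a ≥ 3`:
`ψ_a = (Φχ_a)′` is an odd test function on `[−a, a]`, so `ε_od(a) ‖ψ_a‖₂² ≤ Re Q(ψ_a) ≤ ‖Q(ψ_a)‖`
(`weilOddGroundEnergy_mul_le_re`), with `‖ψ_a‖₂² ≥ N₁` and `‖Q(ψ_a)‖` double-exponentially small.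
[folklore] -/
theorem weilOddGroundEnergy_le_superexp :
    ∃ C : ℝ, 0 ≤ C ∧ ∀ a : ℝ, 3 ≤ a →
      weilOddGroundEnergy a ≤ C * Real.exp (-(π / 2 * Real.exp (2 * (a - 1)))) := by
  obtain ⟨C, hC, hQ⟩ := exists_norm_weilQuadratic_deriv_phiCut_le
  obtain ⟨N₁, hN₁, hN⟩ := exists_integral_norm_sq_deriv_phiCut_ge
  refine ⟨C / N₁, by positivity, fun a ha => ?_⟩
  set ψ : ℝ → ℂ := deriv (fun t : ℝ => (2 : ℂ) * LagariasMontague.Psic (2 * t) *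
    ((Literature.Analysis.Calculus.cutoff a t : ℝ) : ℂ)) with hψdef
  have hψ : IsWeilTest ψ := (isWeilTest_phiCut a).deriv
  have hsupp : tsupport ψ ⊆ Icc (-a) a := tsupport_deriv_subset.trans (tsupport_phiCut_subset a)
  have hodd : ∀ t, ψ (-t) = -ψ t := fun t => deriv_phiCut_neg a t
  have hpos : 0 < ∫ t : ℝ, ‖ψ t‖ ^ 2 := hN₁.trans_le (hN a ha)
  have h1 : weilOddGroundEnergy a * ∫ t : ℝ, ‖ψ t‖ ^ 2 ≤ (weilQuadratic ψ).re :=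
    Literature.NumberTheory.LFunctions.weilOddGroundEnergy_mul_le_re hψ hsupp hodd
  have h2 : (weilQuadratic ψ).re ≤ C * Real.exp (-(π / 2 * Real.exp (2 * (a - 1)))) :=
    (Complex.re_le_norm _).trans (hQ a (by linarith))
  have h3 : weilOddGroundEnergy a ≤ (weilQuadratic ψ).re / ∫ t : ℝ, ‖ψ t‖ ^ 2 := by
    rw [le_div_iff₀ hpos]; exact h1
  have h4 : (weilQuadratic ψ).re / ∫ t : ℝ, ‖ψ t‖ ^ 2 ≤
      C * Real.exp (-(π / 2 * Real.exp (2 * (a - 1)))) / N₁ := by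
    rcases le_or_gt 0 (weilQuadratic ψ).re with hq | hq
    · exact div_le_div₀ (by positivity) h2 hN₁ (hN a ha)
    · exact (div_neg_of_neg_of_pos hq hpos).le.trans (by positivity)
  calc weilOddGroundEnergy a ≤ _ := h3
    _ ≤ _ := h4
    _ = C / N₁ * Real.exp (-(π / 2 * Real.exp (2 * (a - 1)))) := by ring

/-- **`limsup_{a→∞} ε_od(a) ≤ 0`, unconditionally**: for every `δ > 0`, `ε_od(a) ≤ δ` for all large
`a`. [folklore] -/
theorem weilOddGroundEnergy_eventually_le {δ : ℝ} (hδ : 0 < δ) :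
    ∀ᶠ a : ℝ in atTop, weilOddGroundEnergy a ≤ δ := by
  obtain ⟨C, -, hC⟩ := weilOddGroundEnergy_le_superexp
  filter_upwards [eventually_ge_atTop (3 : ℝ),
    (tendsto_superexpBound_zero C).eventually (ge_mem_nhds hδ)] with a ha hb
  exact (hC a ha).trans hb

/-- **Under RH, `0 ≤ ε_od(a) ≤ C exp(−(π/2)e^{2(a−1)})` for `a ≥ 3`** — the odd ground energy is
squeezed double-exponentially (lower bound: Weil positivity, `weilOddGroundEnergy_nonneg_of_riemannHypothesis`).
[folklore] -/
theorem weilOddGroundEnergy_mem_Icc_of_riemannHypothesis (hRH : _root_.RiemannHypothesis) :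
    ∃ C : ℝ, 0 ≤ C ∧ ∀ a : ℝ, 3 ≤ a →
      weilOddGroundEnergy a ∈ Icc 0 (C * Real.exp (-(π / 2 * Real.exp (2 * (a - 1))))) := by
  obtain ⟨C, hC, h⟩ := weilOddGroundEnergy_le_superexp
  exact ⟨C, hC, fun a ha => ⟨weilOddGroundEnergy_nonneg_of_riemannHypothesis hRH a, h a ha⟩⟩

/-- **Under RH, `ε_od(a) → 0`.** [folklore] -/
theorem tendsto_weilOddGroundEnergy_zero_of_riemannHypothesis (hRH : _root_.RiemannHypothesis) :
    Tendsto weilOddGroundEnergy atTop (𝓝 0) := by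
  obtain ⟨C, -, hC⟩ := weilOddGroundEnergy_le_superexp
  refine tendsto_of_tendsto_of_tendsto_of_le_of_le' tendsto_const_nhds (tendsto_superexpBound_zero C)
    (Eventually.of_forall fun a => weilOddGroundEnergy_nonneg_of_riemannHypothesis hRH a) ?_
  filter_upwards [eventually_ge_atTop (3 : ℝ)] with a ha using hC a ha

/-- **RH ⟺ the odd ground energy tends to `0` (registered sub-goal
`riemannHypothesis_iff_tendsto_weilOddGroundEnergy_zero` of item stmt-RiemannHypothesis-17778).**
`→`: the squeeze. `←`: a null sequence `ε_od` is an energy floor `ε_od(a) ≥ −e(a)` with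
`e := −ε_od → 0` at every window, and `riemannHypothesis_iff_energyFloorWindows`. [folklore] -/
theorem riemannHypothesis_iff_tendsto_weilOddGroundEnergy_zero :
    _root_.RiemannHypothesis ↔ Tendsto weilOddGroundEnergy atTop (𝓝 0) := by
  refine ⟨tendsto_weilOddGroundEnergy_zero_of_riemannHypothesis, fun h => ?_⟩
  refine riemannHypothesis_iff_energyFloorWindows.2 ⟨fun a => -weilOddGroundEnergy a,
    by simpa using h.neg, fun A => ⟨A, le_rfl, by simp⟩⟩

/-- **DICHOTOMY for the odd ground energy (RH-free)**: as the window grows, either `ε_od(a) → 0`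
(iff RH) or `ε_od(a) ≤ −η < 0` beyond some height (iff ¬RH). [folklore] -/
theorem tendsto_weilOddGroundEnergy_zero_or_eventually_le_neg :
    Tendsto weilOddGroundEnergy atTop (𝓝 0) ∨
      ∃ η : ℝ, 0 < η ∧ ∃ A : ℝ, ∀ a : ℝ, A ≤ a → weilOddGroundEnergy a ≤ -η := by
  by_cases h : _root_.RiemannHypothesis
  · exact Or.inl (riemannHypothesis_iff_tendsto_weilOddGroundEnergy_zero.1 h)
  · exact Or.inr (not_riemannHypothesis_iff_eventually_weilOddGroundEnergy_le_neg.1 h)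

end Summit.RiemannHypothesis.RiemannHypothesis.Theorems.OddSector

end
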